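import Literature.NumberTheory.EllipticCurves.PAdicMeasureTransform
import HarnessLib

/-!
# Moments of an admissible `p`-adic distribution and the values `∫_{ℤ_p^×} ⟨x⟩ʲ dμ` of its transform

`Literature.NumberTheory.EllipticCurves.PAdicMeasureTransform` attaches to a bounded `ℚ_p`-valued
distribution `μ` on `ℤ_p` the bounded power series `L_μ(T) = ∫_{ℤ_p^×} (1 + T)^{ℓ(x)} dμ(x)` and
evaluates it at the points `T = χ(γ) − 1` of finite-order characters.  For the interpolation
property of the Mazur–Tate–Teitelbaum `p`-adic `L`-function of a form of weight `k ≥ 3` one needs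
its values at the points `T = γʲ − 1` of the characters `x ↦ ⟨x⟩ʲ` (`0 ≤ j ≤ k − 2`), which are
the moments `∫_{ℤ_p^×} xʲ dμ` when `τ ∣ j` (`τ = |μ_torsion(ℤ_p)|`, so that `xʲ = ⟨x⟩ʲ`), and the
identification of these moments with the values of the polynomial-weighted distributions
furnished by the modular symbol (Mazur–Tate–Teitelbaum 1986, §I.11, "`h`-admissible measures"
with `h = 0`; Višik 1976; Amice–Vélu 1975).  This file proves the abstract `p`-adic statements:

* `exists_powerSeries_of_bounded_distribution'` — the transform of `PAdicMeasureTransform` with its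
  coefficients exposed as the limits of the Riemann sums `RS k n` (same construction);
* `hasSum_coeff_mul_pow_of_tendsto_levelSum` — **evaluation inside the unit disc**: if the level
  sums `∑_η ∑_s μ(ηγˢ + p^{n+e₀}) (1 + T)ˢ` converge to `V` (`‖T‖ < 1`), then `L_μ(T) = V`;
* `tendsto_sum_mul_pow_of_moment`, `tendsto_sum_units_mul_pow_of_moment` — **moments of an
  admissible family**: if `ν` is a second distribution with `‖ν(a + pⁿ) − aʲ μ(a + pⁿ)‖ ≤ C p⁻ⁿ`
  (the `j`-th moment distribution of a measure of slope `0`), then the Riemann sums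
  `∑_{a mod pⁿ} μ(a + pⁿ) x_aʲ` (`x_a ≡ a`) converge to `ν(ℤ_p)`, and over the units to
  `ν(ℤ_p) − ν(pℤ_p)`;
* `hasSum_coeff_mul_cyclotomicGenerator_pow_sub_one` — consequently, for `τ ∣ j`,
  **`L_μ(γʲ − 1) = ∫_{ℤ_p^×} xʲ dμ = ν(ℤ_p) − ν(pℤ_p)`**.

Everything is proved; there are no named facts.

## References

* B. Mazur, J. Tate, J. Teitelbaum, *On `p`-adic analogues of the conjectures of Birch and
  Swinnerton-Dyer*, Invent. Math. 84 (1986), §I.11 (`h`-admissible measures, integration of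
  `xʲ`), §I.13 (characters `x ↦ ⟨x⟩ʲ χ(x)`), §I.14 (14.3).
* M. M. Višik, *Non-archimedean measures connected with Dirichlet series*, Mat. Sb. 99 (1976), §1–2.
-/

noncomputable section

open Filter Topology

namespace Literature.NumberTheory.EllipticCurves

variable {p : ℕ} [Fact p.Prime]

/-! ### The Riemann sums over `ℚ_p` and evaluation inside the disc -/

section RiemannSums

variable {μ : (n : ℕ) → ZMod (p ^ n) → ℚ_[p]} {RS : ℕ → ℕ → ℚ_[p]}
  (hRS : ∀ k n : ℕ, RS k n =
      ∑ᶠ η : rootsOfUnity (torsionOrder p) ℤ_[p], ∑ s : ZMod (p ^ n),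
        μ (n + cyclotomicExponent p)
            (PadicInt.toZModPow (n + cyclotomicExponent p) ((η : ℤ_[p]ˣ) : ℤ_[p]) *
              (cyclotomicGenerator p : ZMod (p ^ (n + cyclotomicExponent p))) ^ s.val) *
          ((s.val.choose k : ℕ) : ℚ_[p]))

include hRS

/-- **Binomial expansion of the Riemann sums over `ℚ_p`**: for `T ∈ ℚ_p` and every level `n`,
`∑_k RS k n T^k = ∑_η ∑_{s mod p^n} μ(η γ^s + p^{n+e₀}) (1 + T)^s` (a finite sum; the `ℚ_p`-valued
form of `hasSum_riemannSum_mul_pow`). [folklore] -/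
theorem hasSum_riemannSum_mul_pow' (n : ℕ) (T : ℚ_[p]) :
    HasSum (fun k : ℕ ↦ RS k n * T ^ k)
      (∑ᶠ η : rootsOfUnity (torsionOrder p) ℤ_[p], ∑ s : ZMod (p ^ n),
        μ (n + cyclotomicExponent p)
          (PadicInt.toZModPow (n + cyclotomicExponent p) ((η : ℤ_[p]ˣ) : ℤ_[p]) *
            (cyclotomicGenerator p : ZMod (p ^ (n + cyclotomicExponent p))) ^ s.val) *
          (1 + T) ^ s.val) := by
  classical
  haveI := neZero_torsionOrder p
  haveI := Fintype.ofFinite (rootsOfUnity (torsionOrder p) ℤ_[p])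
  haveI : NeZero (p ^ n) := ⟨pow_ne_zero _ (Fact.out : p.Prime).ne_zero⟩
  have hzero : ∀ k ∉ Finset.range (p ^ n), RS k n * T ^ k = 0 := by
    intro k hk
    rw [Finset.mem_range, not_lt] at hk
    rw [riemannSum_eq_zero_of_le hRS hk, zero_mul]
  have key : ∑ k ∈ Finset.range (p ^ n), RS k n * T ^ k =
      ∑ᶠ η : rootsOfUnity (torsionOrder p) ℤ_[p], ∑ s : ZMod (p ^ n),
        μ (n + cyclotomicExponent p)
          (PadicInt.toZModPow (n + cyclotomicExponent p) ((η : ℤ_[p]ˣ) : ℤ_[p]) *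
            (cyclotomicGenerator p : ZMod (p ^ (n + cyclotomicExponent p))) ^ s.val) *
          (1 + T) ^ s.val := by
    simp only [hRS, finsum_eq_sum_of_fintype, Finset.sum_mul]
    rw [Finset.sum_comm]
    refine Finset.sum_congr rfl fun η _ ↦ ?_
    rw [Finset.sum_comm]
    refine Finset.sum_congr rfl fun s _ ↦ ?_
    rw [← sum_range_choose_mul_pow T (ZMod.val_lt s), Finset.mul_sum]
    refine Finset.sum_congr rfl fun k _ ↦ ?_
    ring
  rw [← key]
  exact hasSum_sum_of_ne_finset_zero hzero

/-- **Evaluation of the transform inside the unit disc** (Mazur–Tate–Teitelbaum 1986, §I.13): if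
`‖μ‖ ≤ C`, the Riemann sums `RS k n` converge to `c_k` for every `k`, `‖T‖ < 1`, and the level sums
`∑_η ∑_{s mod p^n} μ(η γ^s + p^{n+e₀}) (1 + T)^s` converge to `V`, then `∑_k c_k T^k = V` — dominated
convergence (Tannery) for `∑_k RS k n T^k`, which is the level-`n` sum
(`hasSum_riemannSum_mul_pow'`). [folklore] -/
theorem hasSum_coeff_mul_pow_of_tendsto_levelSum
    {C : ℝ} (hC : ∀ (n : ℕ) (a : ZMod (p ^ n)), ‖μ n a‖ ≤ C)
    {c : ℕ → ℚ_[p]} (hc : ∀ k, Tendsto (fun n ↦ RS k n) atTop (𝓝 (c k)))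
    {T : ℚ_[p]} (hT : ‖T‖ < 1) {V : ℚ_[p]}
    (hV : Tendsto (fun n ↦ ∑ᶠ η : rootsOfUnity (torsionOrder p) ℤ_[p], ∑ s : ZMod (p ^ n),
        μ (n + cyclotomicExponent p)
          (PadicInt.toZModPow (n + cyclotomicExponent p) ((η : ℤ_[p]ˣ) : ℤ_[p]) *
            (cyclotomicGenerator p : ZMod (p ^ (n + cyclotomicExponent p))) ^ s.val) *
          (1 + T) ^ s.val) atTop (𝓝 V)) :
    HasSum (fun k : ℕ ↦ c k * T ^ k) V := by
  have hC0 : 0 ≤ C := (norm_nonneg _).trans (hC 0 0)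
  have hRSb : ∀ k n, ‖RS k n‖ ≤ C := norm_riemannSum_le hRS hC
  have hcoeff : ∀ k, ‖c k‖ ≤ C := fun k ↦
    le_of_tendsto (hc k).norm (Eventually.of_forall fun n ↦ hRSb k n)
  have hbound : Summable fun k : ℕ ↦ C * ‖T‖ ^ k :=
    (summable_geometric_of_lt_one (norm_nonneg _) hT).mul_left C
  have hlim : Tendsto (fun n ↦ ∑' k, RS k n * T ^ k) atTop (𝓝 (∑' k, c k * T ^ k)) := by
    refine tendsto_tsum_of_dominated_convergence hbound (fun k ↦ (hc k).mul tendsto_const_nhds)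
      (Eventually.of_forall fun n k ↦ ?_)
    rw [norm_mul, norm_pow]
    exact mul_le_mul_of_nonneg_right (hRSb k n) (pow_nonneg (norm_nonneg _) _)
  have hlim' : Tendsto (fun n ↦ ∑' k, RS k n * T ^ k) atTop (𝓝 V) :=
    hV.congr fun n ↦ ((hasSum_riemannSum_mul_pow' hRS n T).tsum_eq).symm
  have huniq : ∑' k, c k * T ^ k = V := tendsto_nhds_unique hlim hlim'
  have hsumm : Summable fun k : ℕ ↦ c k * T ^ k := by
    refine Summable.of_norm_bounded hbound fun k ↦ ?_
    rw [norm_mul, norm_pow]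
    exact mul_le_mul_of_nonneg_right (hcoeff k) (pow_nonneg (norm_nonneg _) _)
  exact hsumm.hasSum_iff.mpr huniq

end RiemannSums

/-! ### The transform with its coefficients exposed -/

section Transform

/-- **The `p`-adic Mellin transform, with its coefficients as limits of Riemann sums**: the power
series `L_μ` of `exists_powerSeries_of_bounded_distribution` (same construction), together with
`[T^k] L_μ = lim_n RS k n = ∫_{ℤ_p^×} (ℓ(x) choose k) dμ` (Mazur–Tate–Teitelbaum 1986, §I.11–I.14).
[cite: MazurTateTeitelbaum1986Invent, §I.13–I.14 (14.3)] -/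
theorem exists_powerSeries_of_bounded_distribution' {μ : (n : ℕ) → ZMod (p ^ n) → ℚ_[p]}
    (hdist : ∀ (n : ℕ) (a : ZMod (p ^ n)),
      ∑ b ∈ Finset.univ.filter (fun b : ZMod (p ^ (n + 1)) ↦
        ZMod.castHom (pow_dvd_pow p n.le_succ) (ZMod (p ^ n)) b = a), μ (n + 1) b = μ n a)
    {C : ℝ} (hC : ∀ (n : ℕ) (a : ZMod (p ^ n)), ‖μ n a‖ ≤ C) :
    ∃ L : PowerSeries ℚ_[p],
      (∀ k : ℕ, ‖PowerSeries.coeff k L‖ ≤ C) ∧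
      (∀ k : ℕ, Tendsto (fun n ↦
        ∑ᶠ η : rootsOfUnity (torsionOrder p) ℤ_[p], ∑ s : ZMod (p ^ n),
          μ (n + cyclotomicExponent p)
              (PadicInt.toZModPow (n + cyclotomicExponent p) ((η : ℤ_[p]ˣ) : ℤ_[p]) *
                (cyclotomicGenerator p : ZMod (p ^ (n + cyclotomicExponent p))) ^ s.val) *
            ((s.val.choose k : ℕ) : ℚ_[p])) atTop (𝓝 (PowerSeries.coeff k L))) ∧
      PowerSeries.constantCoeff L =
        ∑ u : (ZMod (p ^ cyclotomicExponent p))ˣ, μ (cyclotomicExponent p) u ∧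
      ∀ (m : ℕ) (χ : DirichletCharacter ℂ_[p] (p ^ (m + 1))), χ.Even →
        (∃ j : ℕ, orderOf χ = p ^ j) →
          HasSum (fun k : ℕ ↦ algebraMap ℚ_[p] ℂ_[p] (PowerSeries.coeff k L) *
              (χ (cyclotomicGenerator p : ZMod (p ^ (m + 1))) - 1) ^ k)
            (∑ a : ZMod (p ^ (m + 1)), χ a * algebraMap ℚ_[p] ℂ_[p] (μ (m + 1) a)) := by
  set RS : ℕ → ℕ → ℚ_[p] := fun k n ↦
    ∑ᶠ η : rootsOfUnity (torsionOrder p) ℤ_[p], ∑ s : ZMod (p ^ n),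
      μ (n + cyclotomicExponent p)
          (PadicInt.toZModPow (n + cyclotomicExponent p) ((η : ℤ_[p]ˣ) : ℤ_[p]) *
            (cyclotomicGenerator p : ZMod (p ^ (n + cyclotomicExponent p))) ^ s.val) *
        ((s.val.choose k : ℕ) : ℚ_[p]) with hRS_def
  have hRS : ∀ k n : ℕ, RS k n =
      ∑ᶠ η : rootsOfUnity (torsionOrder p) ℤ_[p], ∑ s : ZMod (p ^ n),
        μ (n + cyclotomicExponent p)
            (PadicInt.toZModPow (n + cyclotomicExponent p) ((η : ℤ_[p]ˣ) : ℤ_[p]) *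
              (cyclotomicGenerator p : ZMod (p ^ (n + cyclotomicExponent p))) ^ s.val) *
          ((s.val.choose k : ℕ) : ℚ_[p]) := fun _ _ ↦ rfl
  refine ⟨PowerSeries.mk fun k ↦ limUnder atTop fun n ↦ RS k n, fun k ↦ ?_, fun k ↦ ?_, ?_,
    fun m χ heven hord ↦ ?_⟩
  · rw [PowerSeries.coeff_mk]
    exact norm_limUnder_riemannSum_le_of_distribution hRS hdist hC k
  · rw [PowerSeries.coeff_mk]
    exact tendsto_riemannSum_of_distribution hRS hdist hC k
  · rw [← PowerSeries.coeff_zero_eq_constantCoeff_apply, PowerSeries.coeff_mk]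
    exact (tendsto_const_nhds.congr fun n ↦
      (riemannSum_zero_of_distribution hRS hdist n).symm).limUnder_eq
  · simp only [PowerSeries.coeff_mk]
    exact hasSum_limUnder_riemannSum_mul_pow_of_distribution hRS hdist hC χ heven hord

end Transform

/-! ### Moments of an admissible family -/

section Moments

variable {μ ν : (n : ℕ) → ZMod (p ^ n) → ℚ_[p]}

/-- At level `0` the fibre condition is vacuous: every class reduces to `0 ∈ ℤ/p⁰`. [folklore] -/
theorem filter_castHom_level_zero (L : ℕ) :
    Finset.univ.filter (fun b : ZMod (p ^ L) ↦
      ZMod.castHom (pow_dvd_pow p (Nat.zero_le L)) (ZMod (p ^ 0)) b = 0) = Finset.univ := by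
  refine Finset.filter_true_of_mem fun b _ ↦ ?_
  haveI : Subsingleton (ZMod (p ^ 0)) := ZMod.subsingleton_iff.mpr (pow_zero p)
  exact Subsingleton.elim _ _

/-- **Total mass along the distribution relation**: `ν(ℤ_p) = ∑_{a mod p^L} ν(a + p^L ℤ_p)`.
[folklore] -/
theorem sum_level_eq_of_distribution
    (hdist : ∀ (n : ℕ) (a : ZMod (p ^ n)),
      ∑ b ∈ Finset.univ.filter (fun b : ZMod (p ^ (n + 1)) ↦
        ZMod.castHom (pow_dvd_pow p n.le_succ) (ZMod (p ^ n)) b = a), ν (n + 1) b = ν n a)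
    (L : ℕ) : ∑ a : ZMod (p ^ L), ν L a = ν 0 0 := by
  rw [← sum_fiber_of_distribution hdist (Nat.zero_le L) (0 : ZMod (p ^ 0)),
    filter_castHom_level_zero]

/-- **Mass of `pℤ_p` along the distribution relation**: for `1 ≤ L`,
`ν(pℤ_p) = ∑_{a mod p^L, p ∣ a} ν(a + p^L ℤ_p)`, the non-units modulo `p^L`. [folklore] -/
theorem sum_filter_not_isUnit_eq_of_distribution
    (hdist : ∀ (n : ℕ) (a : ZMod (p ^ n)),
      ∑ b ∈ Finset.univ.filter (fun b : ZMod (p ^ (n + 1)) ↦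
        ZMod.castHom (pow_dvd_pow p n.le_succ) (ZMod (p ^ n)) b = a), ν (n + 1) b = ν n a)
    {L : ℕ} (hL : 1 ≤ L) :
    ∑ a ∈ Finset.univ.filter (fun a : ZMod (p ^ L) ↦ ¬ IsUnit a), ν L a = ν 1 0 := by
  rw [← sum_fiber_of_distribution hdist hL (0 : ZMod (p ^ 1))]
  refine Finset.sum_congr ?_ fun _ _ ↦ rfl
  ext a
  simp only [Finset.mem_filter, Finset.mem_univ, true_and]
  rw [isUnit_iff_isUnit_castHom le_rfl hL a, isUnit_iff_ne_zero_level_one, not_not]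

/-- **Sample points**: if `x ∈ ℤ_p` reduces to the class `a` modulo `p^n`, then
`‖x^j − (a.val)^j‖ ≤ p^{−n}` (`x ≡ a.val mod p^n` and `x − y ∣ x^j − y^j`). [folklore] -/
theorem norm_pow_sub_natCast_pow_le {n : ℕ} {x : ℤ_[p]} {a : ZMod (p ^ n)}
    (hx : PadicInt.toZModPow n x = a) (j : ℕ) :
    ‖(x : ℚ_[p]) ^ j - ((a.val : ℕ) : ℚ_[p]) ^ j‖ ≤ (p : ℝ) ^ (-(n : ℤ)) := by
  haveI : NeZero (p ^ n) := ⟨pow_ne_zero _ (Fact.out : p.Prime).ne_zero⟩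
  have hmem : x - (a.val : ℤ_[p]) ∈ Ideal.span {(p : ℤ_[p]) ^ n} := by
    rw [← PadicInt.ker_toZModPow, RingHom.mem_ker, map_sub, hx, map_natCast, ZMod.natCast_zmod_val,
      sub_self]
  have h1 : ‖x - (a.val : ℤ_[p])‖ ≤ (p : ℝ) ^ (-(n : ℤ)) :=
    (PadicInt.norm_le_pow_iff_mem_span_pow _ _).mpr hmem
  obtain ⟨c, hc⟩ := sub_dvd_pow_sub_pow x (a.val : ℤ_[p]) j
  have h2 : ‖x ^ j - (a.val : ℤ_[p]) ^ j‖ ≤ (p : ℝ) ^ (-(n : ℤ)) := by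
    rw [hc, norm_mul]
    calc _ ≤ (p : ℝ) ^ (-(n : ℤ)) * 1 :=
          mul_le_mul h1 (PadicInt.norm_le_one c) (norm_nonneg _) (by positivity)
      _ = _ := mul_one _
  have e : (x : ℚ_[p]) ^ j - ((a.val : ℕ) : ℚ_[p]) ^ j = ((x ^ j - (a.val : ℤ_[p]) ^ j : ℤ_[p]) : ℚ_[p]) := by
    push_cast; rfl
  rw [e, PadicInt.padic_norm_e_of_padicInt]
  exact h2

/-- **Riemann sums of `xʲ` against a measure of slope `0` compute the `j`-th moment**
(Mazur–Tate–Teitelbaum 1986, §I.11; Višik 1976): if `‖μ‖ ≤ C`, `ν` satisfies the distribution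
relation and `‖ν(a + pⁿ) − (a.val)ʲ μ(a + pⁿ)‖ ≤ C p⁻ⁿ`, then for any sample points `x_{n,a} ≡ a`
(at the levels `n + e`) the sums `∑_{a mod p^{n+e}} μ(a + p^{n+e}) x_{n,a}ʲ` tend to `ν(ℤ_p)`: each
term differs from `ν(a + p^{n+e})` by at most `C p^{-(n+e)}` and `ℚ_p` is ultrametric. [cite: MazurTateTeitelbaum1986Invent, §I.11] -/
theorem tendsto_sum_mul_pow_of_moment (j e : ℕ)
    (hνdist : ∀ (n : ℕ) (a : ZMod (p ^ n)),
      ∑ b ∈ Finset.univ.filter (fun b : ZMod (p ^ (n + 1)) ↦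
        ZMod.castHom (pow_dvd_pow p n.le_succ) (ZMod (p ^ n)) b = a), ν (n + 1) b = ν n a)
    {C : ℝ} (hC : ∀ (n : ℕ) (a : ZMod (p ^ n)), ‖μ n a‖ ≤ C)
    (hν : ∀ (n : ℕ) (a : ZMod (p ^ n)),
      ‖ν n a - ((a.val : ℕ) : ℚ_[p]) ^ j * μ n a‖ ≤ C * (p : ℝ) ^ (-(n : ℤ)))
    (x : (n : ℕ) → ZMod (p ^ (n + e)) → ℤ_[p]) (hx : ∀ n a, PadicInt.toZModPow (n + e) (x n a) = a) :
    Tendsto (fun n ↦ ∑ a : ZMod (p ^ (n + e)), μ (n + e) a * ((x n a : ℤ_[p]) : ℚ_[p]) ^ j) atTop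
      (𝓝 (ν 0 0)) := by
  have hC0 : 0 ≤ C := (norm_nonneg _).trans (hC 0 0)
  have hp1 : (1 : ℝ) < p := by exact_mod_cast (Fact.out : p.Prime).one_lt
  -- termwise estimate
  have hterm : ∀ (n : ℕ) (a : ZMod (p ^ (n + e))),
      ‖μ (n + e) a * ((x n a : ℤ_[p]) : ℚ_[p]) ^ j - ν (n + e) a‖ ≤ C * (p : ℝ) ^ (-((n + e : ℕ) : ℤ)) := by
    intro n a
    have eq : μ (n + e) a * ((x n a : ℤ_[p]) : ℚ_[p]) ^ j - ν (n + e) a =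
        μ (n + e) a * (((x n a : ℤ_[p]) : ℚ_[p]) ^ j - ((a.val : ℕ) : ℚ_[p]) ^ j) +
          -(ν (n + e) a - ((a.val : ℕ) : ℚ_[p]) ^ j * μ (n + e) a) := by ring
    rw [eq]
    refine (IsUltrametricDist.norm_add_le_max _ _).trans (max_le ?_ ?_)
    · rw [norm_mul]
      exact mul_le_mul (hC _ a) (norm_pow_sub_natCast_pow_le (hx n a) j) (norm_nonneg _) hC0
    · rw [norm_neg]; exact hν _ a
  -- the sums
  have hsum : ∀ n : ℕ, ‖∑ a : ZMod (p ^ (n + e)), μ (n + e) a * ((x n a : ℤ_[p]) : ℚ_[p]) ^ j - ν 0 0‖ ≤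
      C * (p : ℝ) ^ (-((n + e : ℕ) : ℤ)) := by
    intro n
    rw [← sum_level_eq_of_distribution hνdist (n + e), ← Finset.sum_sub_distrib]
    exact IsUltrametricDist.norm_sum_le_of_forall_le_of_nonneg (by positivity) fun a _ ↦ hterm n a
  have hmaj : Tendsto (fun n : ℕ ↦ C * (p : ℝ) ^ (-((n + e : ℕ) : ℤ))) atTop (𝓝 0) := by
    have h := (tendsto_pow_atTop_nhds_zero_of_lt_one
      (inv_nonneg.mpr (le_of_lt (zero_lt_one.trans hp1))) (inv_lt_one_of_one_lt₀ hp1)).const_mul C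
    rw [mul_zero] at h
    refine (h.comp (tendsto_add_atTop_nat e)).congr fun n ↦ ?_
    rw [Function.comp_apply, zpow_neg, zpow_natCast, inv_pow]
  rw [tendsto_iff_norm_sub_tendsto_zero]
  exact squeeze_zero (fun n ↦ norm_nonneg _) hsum hmaj

/-- **The same over the units**: `∑_{a ∈ (ℤ/p^{n+e})^×} μ(a + p^{n+e}) x_{n,a}ʲ → ν(ℤ_p) − ν(pℤ_p) =
"∫_{ℤ_p^×} xʲ dμ"` (`e ≥ 1`; the non-units modulo `p^{n+e}` carry `ν(pℤ_p)`,
`sum_filter_not_isUnit_eq_of_distribution`). [cite: MazurTateTeitelbaum1986Invent, §I.11] -/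
theorem tendsto_sum_units_mul_pow_of_moment (j : ℕ) {e : ℕ} (he : 1 ≤ e)
    (hνdist : ∀ (n : ℕ) (a : ZMod (p ^ n)),
      ∑ b ∈ Finset.univ.filter (fun b : ZMod (p ^ (n + 1)) ↦
        ZMod.castHom (pow_dvd_pow p n.le_succ) (ZMod (p ^ n)) b = a), ν (n + 1) b = ν n a)
    {C : ℝ} (hC : ∀ (n : ℕ) (a : ZMod (p ^ n)), ‖μ n a‖ ≤ C)
    (hν : ∀ (n : ℕ) (a : ZMod (p ^ n)),
      ‖ν n a - ((a.val : ℕ) : ℚ_[p]) ^ j * μ n a‖ ≤ C * (p : ℝ) ^ (-(n : ℤ)))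
    (x : (n : ℕ) → ZMod (p ^ (n + e)) → ℤ_[p]) (hx : ∀ n a, PadicInt.toZModPow (n + e) (x n a) = a) :
    Tendsto (fun n ↦ ∑ u : (ZMod (p ^ (n + e)))ˣ,
        μ (n + e) u * ((x n u : ℤ_[p]) : ℚ_[p]) ^ j) atTop (𝓝 (ν 0 0 - ν 1 0)) := by
  classical
  have hC0 : 0 ≤ C := (norm_nonneg _).trans (hC 0 0)
  have hp1 : (1 : ℝ) < p := by exact_mod_cast (Fact.out : p.Prime).one_lt
  have hterm : ∀ (n : ℕ) (a : ZMod (p ^ (n + e))),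
      ‖μ (n + e) a * ((x n a : ℤ_[p]) : ℚ_[p]) ^ j - ν (n + e) a‖ ≤ C * (p : ℝ) ^ (-((n + e : ℕ) : ℤ)) := by
    intro n a
    have eq : μ (n + e) a * ((x n a : ℤ_[p]) : ℚ_[p]) ^ j - ν (n + e) a =
        μ (n + e) a * (((x n a : ℤ_[p]) : ℚ_[p]) ^ j - ((a.val : ℕ) : ℚ_[p]) ^ j) +
          -(ν (n + e) a - ((a.val : ℕ) : ℚ_[p]) ^ j * μ (n + e) a) := by ring
    rw [eq]
    refine (IsUltrametricDist.norm_add_le_max _ _).trans (max_le ?_ ?_)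
    · rw [norm_mul]
      exact mul_le_mul (hC _ a) (norm_pow_sub_natCast_pow_le (hx n a) j) (norm_nonneg _) hC0
    · rw [norm_neg]; exact hν _ a
  -- the full sum tends to `ν 0 0`, the non-unit part to `ν 1 0`
  have hall := tendsto_sum_mul_pow_of_moment j e hνdist hC hν x hx
  have hnon : Tendsto (fun n ↦ ∑ a ∈ Finset.univ.filter (fun a : ZMod (p ^ (n + e)) ↦ ¬ IsUnit a),
      μ (n + e) a * ((x n a : ℤ_[p]) : ℚ_[p]) ^ j) atTop (𝓝 (ν 1 0)) := by
    have hsum : ∀ n : ℕ, ‖∑ a ∈ Finset.univ.filter (fun a : ZMod (p ^ (n + e)) ↦ ¬ IsUnit a),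
        μ (n + e) a * ((x n a : ℤ_[p]) : ℚ_[p]) ^ j - ν 1 0‖ ≤ C * (p : ℝ) ^ (-((n + e : ℕ) : ℤ)) := by
      intro n
      rw [← sum_filter_not_isUnit_eq_of_distribution hνdist (le_add_left he : 1 ≤ n + e),
        ← Finset.sum_sub_distrib]
      exact IsUltrametricDist.norm_sum_le_of_forall_le_of_nonneg (by positivity)
        fun a _ ↦ hterm n a
    have hmaj : Tendsto (fun n : ℕ ↦ C * (p : ℝ) ^ (-((n + e : ℕ) : ℤ))) atTop (𝓝 0) := by
      have h := (tendsto_pow_atTop_nhds_zero_of_lt_one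
        (inv_nonneg.mpr (le_of_lt (zero_lt_one.trans hp1))) (inv_lt_one_of_one_lt₀ hp1)).const_mul C
      rw [mul_zero] at h
      refine (h.comp (tendsto_add_atTop_nat e)).congr fun n ↦ ?_
      rw [Function.comp_apply, zpow_neg, zpow_natCast, inv_pow]
    rw [tendsto_iff_norm_sub_tendsto_zero]
    exact squeeze_zero (fun n ↦ norm_nonneg _) hsum hmaj
  have hsplit : ∀ n : ℕ, ∑ u : (ZMod (p ^ (n + e)))ˣ, μ (n + e) u * ((x n u : ℤ_[p]) : ℚ_[p]) ^ j =
      ∑ a : ZMod (p ^ (n + e)), μ (n + e) a * ((x n a : ℤ_[p]) : ℚ_[p]) ^ j -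
        ∑ a ∈ Finset.univ.filter (fun a : ZMod (p ^ (n + e)) ↦ ¬ IsUnit a),
          μ (n + e) a * ((x n a : ℤ_[p]) : ℚ_[p]) ^ j := by
    intro n
    haveI : NeZero (p ^ (n + e)) := ⟨pow_ne_zero _ (Fact.out : p.Prime).ne_zero⟩
    rw [sum_units_eq_sum_filter_isUnit (F := fun a : ZMod (p ^ (n + e)) ↦
        μ (n + e) a * ((x n a : ℤ_[p]) : ℚ_[p]) ^ j), eq_sub_iff_add_eq,
      Finset.sum_filter_add_sum_filter_not]
  simp_rw [hsplit]
  exact hall.sub hnon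

end Moments

/-! ### The values `L_μ(γʲ − 1) = ∫_{ℤ_p^×} xʲ dμ` -/

section Values

variable {μ ν : (n : ℕ) → ZMod (p ^ n) → ℚ_[p]}

/-- `‖γʲ − 1‖ < 1` for the topological generator `γ = 1 + p^{e₀}`. [folklore] -/
theorem norm_cyclotomicGenerator_pow_sub_one_lt (j : ℕ) :
    ‖((cyclotomicGenerator p : ℕ) : ℚ_[p]) ^ j - 1‖ < 1 := by
  have h1 : ‖((cyclotomicGenerator p : ℕ) : ℚ_[p]) - 1‖ < 1 := by
    rw [cyclotomicGenerator]
    push_cast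
    rw [add_sub_cancel_left, norm_pow, Padic.norm_p]
    have hp1 : (1 : ℝ) < p := by exact_mod_cast (Fact.out : p.Prime).one_lt
    exact pow_lt_one₀ (by positivity) (inv_lt_one_of_one_lt₀ hp1) (cyclotomicExponent_ne_zero p)
  obtain ⟨c, hc⟩ := sub_dvd_pow_sub_pow (((cyclotomicGenerator p : ℕ) : ℤ_[p])) 1 j
  rw [one_pow] at hc
  have e : ((cyclotomicGenerator p : ℕ) : ℚ_[p]) ^ j - 1 =
      ((((cyclotomicGenerator p : ℕ) : ℤ_[p]) - 1 : ℤ_[p]) : ℚ_[p]) * (c : ℚ_[p]) := by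
    have := congrArg (fun z : ℤ_[p] ↦ (z : ℚ_[p])) hc
    push_cast at this ⊢
    exact this
  rw [e, norm_mul]
  have h1' : ‖((((cyclotomicGenerator p : ℕ) : ℤ_[p]) - 1 : ℤ_[p]) : ℚ_[p])‖ < 1 := by
    push_cast; exact h1
  calc _ ≤ ‖((((cyclotomicGenerator p : ℕ) : ℤ_[p]) - 1 : ℤ_[p]) : ℚ_[p])‖ * 1 :=
        mul_le_mul_of_nonneg_left (by rw [PadicInt.padic_norm_e_of_padicInt]; exact PadicInt.norm_le_one c)
          (norm_nonneg _)
    _ < 1 := by rw [mul_one]; exact h1'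

/-- **The level sums at `T = γʲ − 1` are Riemann sums of `xʲ` over the units** when `τ ∣ j`:
`(1 + T)^s = γ^{js} = (η γ^s)^j` for `η ∈ μ_τ`, and the classes `η γ^s mod p^{n+e₀}` enumerate
`(ℤ/p^{n+e₀})^×` (`finsum_sum_classes_eq_sum_units`), with the sample points `x_u = η γ^s ∈ ℤ_p`.
[cite: MazurTateTeitelbaum1986Invent, §I.13] -/
theorem levelSum_cyclotomicGenerator_pow_eq {j : ℕ} (hj : torsionOrder p ∣ j) (n : ℕ) :
    ∃ x : ZMod (p ^ (n + cyclotomicExponent p)) → ℤ_[p],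
      (∀ a, PadicInt.toZModPow (n + cyclotomicExponent p) (x a) = a) ∧
      ∑ᶠ η : rootsOfUnity (torsionOrder p) ℤ_[p], ∑ s : ZMod (p ^ n),
        μ (n + cyclotomicExponent p)
          (PadicInt.toZModPow (n + cyclotomicExponent p) ((η : ℤ_[p]ˣ) : ℤ_[p]) *
            (cyclotomicGenerator p : ZMod (p ^ (n + cyclotomicExponent p))) ^ s.val) *
          (1 + (((cyclotomicGenerator p : ℕ) : ℚ_[p]) ^ j - 1)) ^ s.val =
      ∑ u : (ZMod (p ^ (n + cyclotomicExponent p)))ˣ,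
        μ (n + cyclotomicExponent p) u * ((x u : ℤ_[p]) : ℚ_[p]) ^ j := by
  classical
  -- sample points: `x(η γ^s mod p^{n+e₀}) = η γ^s`, anything (say `a.val`) elsewhere
  let pt : rootsOfUnity (torsionOrder p) ℤ_[p] × ZMod (p ^ n) → ℤ_[p] := fun q ↦
    ((q.1 : ℤ_[p]ˣ) : ℤ_[p]) * ((cyclotomicGenerator p : ℕ) : ℤ_[p]) ^ q.2.val
  let cls : rootsOfUnity (torsionOrder p) ℤ_[p] × ZMod (p ^ n) → ZMod (p ^ (n + cyclotomicExponent p)) :=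
    fun q ↦ PadicInt.toZModPow (n + cyclotomicExponent p) ((q.1 : ℤ_[p]ˣ) : ℤ_[p]) *
      (cyclotomicGenerator p : ZMod (p ^ (n + cyclotomicExponent p))) ^ q.2.val
  have hcls : ∀ q, PadicInt.toZModPow (n + cyclotomicExponent p) (pt q) = cls q := fun q ↦ by
    simp [pt, cls, map_mul, map_pow, map_natCast]
  let x : ZMod (p ^ (n + cyclotomicExponent p)) → ℤ_[p] := fun a ↦
    if h : ∃ q, cls q = a then pt h.choose else (a.val : ℤ_[p])
  have hxcls : ∀ q, x (cls q) = pt q := by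
    intro q
    have h : ∃ q', cls q' = cls q := ⟨q, rfl⟩
    simp only [x, dif_pos h]
    have := classMap_injective p n (h.choose_spec)
    -- `classMap` is `cls`
    exact congrArg pt this
  refine ⟨x, fun a ↦ ?_, ?_⟩
  · by_cases h : ∃ q, cls q = a
    · obtain ⟨q, rfl⟩ := h
      rw [hxcls, hcls]
    · haveI : NeZero (p ^ (n + cyclotomicExponent p)) := ⟨pow_ne_zero _ (Fact.out : p.Prime).ne_zero⟩
      simp only [x, dif_neg h, map_natCast, ZMod.natCast_zmod_val]
  · rw [← finsum_sum_classes_eq_sum_units p n (fun u ↦ μ (n + cyclotomicExponent p) u * ((x u : ℤ_[p]) : ℚ_[p]) ^ j)]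
    refine finsum_congr fun η ↦ Finset.sum_congr rfl fun s _ ↦ ?_
    -- `γ^{js} = (η γ^s)^j` since `η^j = 1`
    obtain ⟨i, hi⟩ := hj
    have hη' : ((η : ℤ_[p]ˣ) : ℤ_[p]) ^ j = 1 := by
      rw [hi, pow_mul, rootsOfUnity_pow_torsionOrder p η, one_pow]
    have hpt : pt (η, s) ^ j = ((cyclotomicGenerator p : ℕ) : ℤ_[p]) ^ (s.val * j) := by
      simp only [pt]
      rw [mul_pow, hη', one_mul, ← pow_mul]
    change _ = μ (n + cyclotomicExponent p) (cls (η, s)) * ((x (cls (η, s)) : ℤ_[p]) : ℚ_[p]) ^ j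
    rw [hxcls, add_sub_cancel, ← PadicInt.coe_pow, hpt]
    congr 1
    push_cast
    rw [← pow_mul, mul_comm]

/-- **`L_μ(γʲ − 1) = ∫_{ℤ_p^×} xʲ dμ`** (Mazur–Tate–Teitelbaum 1986, §I.13 with `χ = 1`, and §I.11):
let `μ` be bounded, let the coefficients of `L` be the limits of the Riemann sums of `μ`
(`exists_powerSeries_of_bounded_distribution'`, which needs the distribution relation of `μ`), let `ν` be the `j`-th
moment distribution of `μ` (distribution relation and `‖ν(a + pⁿ) − (a.val)ʲ μ(a + pⁿ)‖ ≤ C p⁻ⁿ`),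
and let `τ ∣ j`.  Then `∑_k [T^k]L (γʲ − 1)^k = ν(ℤ_p) − ν(pℤ_p)`. [cite: MazurTateTeitelbaum1986Invent, §I.11 and §I.13] -/
theorem hasSum_coeff_mul_cyclotomicGenerator_pow_sub_one
    {C : ℝ} (hC : ∀ (n : ℕ) (a : ZMod (p ^ n)), ‖μ n a‖ ≤ C)
    {L : PowerSeries ℚ_[p]}
    (hL : ∀ k : ℕ, Tendsto (fun n ↦
        ∑ᶠ η : rootsOfUnity (torsionOrder p) ℤ_[p], ∑ s : ZMod (p ^ n),
          μ (n + cyclotomicExponent p)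
              (PadicInt.toZModPow (n + cyclotomicExponent p) ((η : ℤ_[p]ˣ) : ℤ_[p]) *
                (cyclotomicGenerator p : ZMod (p ^ (n + cyclotomicExponent p))) ^ s.val) *
            ((s.val.choose k : ℕ) : ℚ_[p])) atTop (𝓝 (PowerSeries.coeff k L)))
    {j : ℕ} (hj : torsionOrder p ∣ j)
    (hνdist : ∀ (n : ℕ) (a : ZMod (p ^ n)),
      ∑ b ∈ Finset.univ.filter (fun b : ZMod (p ^ (n + 1)) ↦
        ZMod.castHom (pow_dvd_pow p n.le_succ) (ZMod (p ^ n)) b = a), ν (n + 1) b = ν n a)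
    (hν : ∀ (n : ℕ) (a : ZMod (p ^ n)),
      ‖ν n a - ((a.val : ℕ) : ℚ_[p]) ^ j * μ n a‖ ≤ C * (p : ℝ) ^ (-(n : ℤ))) :
    HasSum (fun k : ℕ ↦ PowerSeries.coeff k L * (((cyclotomicGenerator p : ℕ) : ℚ_[p]) ^ j - 1) ^ k)
      (ν 0 0 - ν 1 0) := by
  choose x hx hsum using fun n ↦ levelSum_cyclotomicGenerator_pow_eq (μ := μ) hj n
  refine hasSum_coeff_mul_pow_of_tendsto_levelSum (μ := μ) (fun _ _ ↦ rfl) hC hL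
    (norm_cyclotomicGenerator_pow_sub_one_lt j) ?_
  simp_rw [hsum]
  exact tendsto_sum_units_mul_pow_of_moment j
    (Nat.pos_of_ne_zero (cyclotomicExponent_ne_zero p)) hνdist hC hν x hx

end Values

end Literature.NumberTheory.EllipticCurves
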